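import Summits.ResolutionOfSingularities.ResolutionOfSingularities.Theorems.FrobeniusClosingSteerNonRationalWindowWords
import Summits.ResolutionOfSingularities.ResolutionOfSingularities.Theorems.FrobeniusClosingSteerArithReductionOneAxis
import HarnessLib

/-!
# hH2′ residue word — the NRA CUT, part 2: the PROVED GLUE up to hH2′ BY NAME (`frequently_or_split`, `lateBinaryAStage_of_nonRationalAWindows`,
  `lateSwitchBinaryAStage_of_trichotomy`, `uniaxialAStagesNotEternal_of_H3oneAxis`, `lateSwitchBinaryAStage_of_words`) + §2 **W-NRA-U DISCHARGED**
  (`h3OneAxisTwoN_holds`, `uniaxialAStagesNotEternalTwoN_holds`, `lateSwitchBinaryAStage_of_A_B`)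

OURS (campaign `res-hironaka`, rung L ★L-G4, slot W4.1 · crux `Steer` (stmt-ResolutionOfSingularities-16345) · hARᵒ slot H2′ =
`ArithLeaf.LateSwitchBinaryAStageTwoN`). This module is the theorem half of res-L0-w41-strat-2 g4ʼs words file
`L/res-L0-w41-strat-2/NRA/NonRationalAWindow_words_v3.lean` sha16 9caa8decdca80901 (res-L0-w41-tri-1 TRIAGE v6.52 PASS ×4), split off VERBATIM
(theorem blocks byte-identical; only this header, the import of part 1 and the namespace scaffolding are new) because the gate caps Theorems files
with proofs at 400 lines; part 1 `…NonRationalWindowWords` carries the seven `def … : Prop` words and the full module docstring. Filed by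
res-D-pv-036 g11 (res-L0-w41-plan-1 RULING 291 (a) «036 FILES THE WORDS», RULING 297 (c)). §2 (res-D-pv-036 g11, RULING 288 (b)(2) FILE 2, custody
res-plan-2 RECORD #72 (1)) DISCHARGES the one-axis word: `h3OneAxisTwoN_holds : H3OneAxisTwoN` by `ArithReductionLegality.H3_oneAxis_of_pieces`
(`…ArithReductionOneAxis`, p568652), hence W-NRA-U `uniaxialAStagesNotEternalTwoN_holds : UniaxialAStagesNotEternalTwoN` by the glue, and hH2′
(`ArithLeaf.LateSwitchBinaryAStageTwoN`) is closed modulo W-NRA-A (`NonRationalAWindowTwoN`) and W-NRA-B (`NonRationalBWindowsTwoN`) only: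
`lateSwitchBinaryAStage_of_A_B`. Candidates, not facts; nothing here is a statement of H. Hironakaʼs manuscript [claim: Hironaka2017, status:
under-review]; AI-written, AI review is weaker than expert review. [cite: Matsumura1987, Thm. 14.2] [folklore]
-/

-- `Summit.<S>.<S>.…` duplicates the summit name by design (single-problem summit).
set_option linter.dupNamespace false

open IsLocalRing
open Literature.AlgebraicGeometry.Resolution
open Summit.ResolutionOfSingularities.ResolutionOfSingularities.Theorems.SwitchingDichotomy.Words
open Summit.ResolutionOfSingularities.ResolutionOfSingularities.Theorems.SteerRankThinness (Concl HasProperCoarsening)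
open Summit.ResolutionOfSingularities.ResolutionOfSingularities.Theorems.SwitchingDichotomy.ArithReduction
open Summit.ResolutionOfSingularities.ResolutionOfSingularities.Theorems.SwitchingDichotomy

namespace Summit.ResolutionOfSingularities.ResolutionOfSingularities.Theorems.SwitchingDichotomy.NonRationalWindow

variable {K : Type} [Field K]

/-- Pure logic: if `A i ∧ (B i ∨ U i)` holds beyond every stage, then either `A i ∧ B i` holds beyond every stage or `A i ∧ U i ∧ ¬ B i` does.
OURS. (folklore) -/
theorem frequently_or_split {A B U : ℕ → Prop} (h : ∀ i₀, ∃ i, i₀ ≤ i ∧ A i ∧ (B i ∨ U i)) :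
    (∀ i₀, ∃ i, i₀ ≤ i ∧ A i ∧ B i) ∨ (∀ i₀, ∃ i, i₀ ≤ i ∧ A i ∧ U i ∧ ¬ B i) := by
  by_contra hc
  push Not at hc
  obtain ⟨⟨N, hN⟩, ⟨M, hM⟩⟩ := hc
  obtain ⟨i, hi, hA, hBU⟩ := h (max N M)
  have hNi : N ≤ i := (le_max_left _ _).trans hi
  have hMi : M ≤ i := (le_max_right _ _).trans hi
  rcases hBU with hB | hU
  · exact hN i hNi hA hB
  · exact hN i hNi hA (hM i hMi hA hU)

/-- **The run-level reading from the two words** (pure logic): W-NRA-A at every late non-rational A-window gives the binary or the uniaxial datum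
(w.r.t. the stepʼs exceptional parameter, which exists by the runʼs step clause); W-NRA-U removes the uniaxial-not-binary alternative beyond some
stage; hence the binary datum beyond every stage, i.e. hH2′ʼs conclusion. OURS. (folklore) -/
theorem lateBinaryAStage_of_nonRationalAWindows (hW : NonRationalAWindowTwoN) (hU : UniaxialAStagesNotEternalTwoN) :
    LateBinaryAStageOfNonRationalAWindowsTwoN := by
  intro p hp k K _ _ _ _ _ O A₀ h₀ t core hrk R P s hR0 hN hrun hnd hhigh h2inf hinf hwild hnp hodd hreg hdim N₁ h0 h1 HΓ d i₁ hdo hd3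
    hred hA hnr
  classical
  -- late thresholds: `N := max N₁ i₁`
  set N := max N₁ i₁ with hNdef
  have h1N : ∀ j, N ≤ j → IsPointStep R P j → ∀ (hs' : s j ^ p ∈ R j) (Q : Ideal (R j)) [Q.IsPrime], Q.height = 1 →
      ¬ SigmaTopLegality.IsSingPrime (R j) p ⟨s j ^ p, hs'⟩ Q :=
    fun j hj hpj => h1 j ((le_max_left _ _).trans hj) hpj
  have HΓN : ∀ (j j' : ℕ) (x : K), N ≤ j → IsVisitPair R P j j' →
      ((∃ h : x ∈ R j, (⟨x, h⟩ : R j) ∈ P j) ∧ x ≠ 0 ∧ ∀ y : R j, y ∈ P j → O.valuation (y : K) ≤ O.valuation x) →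
      ∀ l, j < l → l < j' → ∃ hx : x ∈ R l, P l = Ideal.span {(⟨x, hx⟩ : R l)} :=
    fun j j' x hj => HΓ j j' x ((le_max_left _ _).trans hj)
  have hredN : ∀ i, N ≤ i → IsPointStep R P i → HasReducedOrderAt R s p i d :=
    fun i hi => hred i ((le_max_right _ _).trans hi)
  -- the step clause of the run: an exceptional parameter at every stage
  have hexc : ∀ i, ∃ u : K, (∃ hu : u ∈ R i, (⟨u, hu⟩ : R i) ∈ P i) ∧ u ≠ 0 ∧
      ∀ y : R i, y ∈ P i → O.valuation (y : K) ≤ O.valuation u := by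
    intro i
    obtain ⟨u, g, hu, -, -⟩ := (hrun.2 i).2.2.2.2
    exact ⟨u, hu⟩
  -- W-NRA-A at every late non-rational A-window
  have hBU : ∀ i₀, ∃ i, i₀ ≤ i ∧ (IsAStageAt R P s p i d ∧ ∃ (i' : ℕ) (u : K), IsVisitPair R P i i' ∧
      ¬ (∀ a ∈ R i', ∃ b ∈ R i, O.valuation (a - b) < 1)) ∧
      ((∃ u : K, BinaryAxisDatumAt O R P s p i d u) ∨
       (∃ (i' : ℕ) (u : K), IsVisitPair R P i i' ∧ ¬ (∀ a ∈ R i', ∃ b ∈ R i, O.valuation (a - b) < 1) ∧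
          UniaxialDatumAt O R P s p i d u)) := by
    intro i₀
    obtain ⟨i, i', hi, hAi, hv, hnrat⟩ := hnr (max i₀ N)
    have hNi : N ≤ i := (le_max_right _ _).trans hi
    obtain ⟨u, hu⟩ := hexc i
    refine ⟨i, (le_max_left _ _).trans hi, ⟨hAi, i', u, hv, hnrat⟩, ?_⟩
    rcases hW p hp k K O A₀ h₀ t core R P s hR0 hrun hreg hdim N h1N HΓN d hd3 hredN i i' u hNi hv hAi hu hnrat with hB | hUx
    · exact Or.inl ⟨u, hB⟩
    · exact Or.inr ⟨i', u, hv, hnrat, hUx⟩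
  -- split: binary beyond every stage, or uniaxial-not-binary beyond every stage (the latter excluded by W-NRA-U)
  rcases frequently_or_split hBU with hB | hUU
  · intro i₀
    obtain ⟨i, hi, ⟨hAi, -⟩, u, hl, hs, g, m₁, m₂, Ψ, hrs, hΨ, hmem, hue, hv1, hv2⟩ := hB i₀
    exact ⟨i, hi, hAi, hl, hs, g, m₁, m₂, Ψ, u, hrs, hΨ, hmem, hue, hv1, hv2⟩
  · exfalso
    refine hU p hp k K O A₀ h₀ t core hrk R P s hR0 hN hrun hnd hhigh h2inf hinf hwild hnp hodd hreg hdim N₁ h0 h1 HΓ d i₁ hdo hd3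
      hred hA fun i₀ => ?_
    obtain ⟨i, hi, ⟨hAi, -⟩, ⟨i', u, hv, hnrat, hUx⟩, hnB⟩ := hUU i₀
    exact ⟨i, hi, hAi, i', u, hv, hnrat, hUx, fun hB => hnB ⟨u, hB⟩⟩

/-- **TRICHOTOMY GLUE (pure logic + res-D-repro-2ʼs rational theorem BY NAME): hH2′ from the NRA words.** Case (R) «∃ N, every visit-pair
window ≥ N is residually rational»: `BinaryResidue.lateSwitchBinaryAStage_of_rationalWindows` (p564716) with `N₁ := max N N₁`; else (B2) holds;
then either non-rational A-windows recur (first binder) or (B1) holds and W-NRA-B applies. With `lateBinaryAStage_of_nonRationalAWindows`: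
hH2′ = CLOSED-MODULO {W-NRA-A, W-NRA-U, W-NRA-B}. OURS. (folklore) -/
theorem lateSwitchBinaryAStage_of_trichotomy (hNRA : LateBinaryAStageOfNonRationalAWindowsTwoN) (hB : NonRationalBWindowsTwoN) :
    ArithLeaf.LateSwitchBinaryAStageTwoN := by
  intro p hp k K _ _ _ _ _ O A₀ h₀ t core hrk R P s hR0 hN hrun hnd hhigh h2inf hinf hwild hnp hodd hreg hdim N₁ h0 h1 HΓ d i₁ hdo hd3
    hred hA
  classical
  by_cases hR : ∃ N : ℕ, ∀ j j' : ℕ, N ≤ j → IsVisitPair R P j j' → ∀ a ∈ R j', ∃ b ∈ R j, O.valuation (a - b) < 1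
  · -- (R): all late windows rational — the rational theorem, re-based at `max N N₁`
    obtain ⟨N, hNrat⟩ := hR
    exact BinaryResidue.lateSwitchBinaryAStage_of_rationalWindows p hp k K O A₀ h₀ t core hrk R P s hR0 hN hrun hnd hhigh h2inf hinf
      hwild hnp hodd hreg hdim (max N N₁)
      (fun j hj => h0 j ((le_max_right _ _).trans hj)) (fun j hj => h1 j ((le_max_right _ _).trans hj))
      (fun j j' x hj => HΓ j j' x ((le_max_right _ _).trans hj))
      (fun j j' hj => hNrat j j' ((le_max_left _ _).trans hj)) d i₁ hdo hd3 hred hA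
  · -- ¬(R) = (B2)
    have hB2 : ∀ N : ℕ, ∃ j j' : ℕ, N ≤ j ∧ IsVisitPair R P j j' ∧ ¬ ∀ a ∈ R j', ∃ b ∈ R j, O.valuation (a - b) < 1 := by
      intro N
      by_contra h
      refine hR ⟨N, fun j j' hj hv => ?_⟩
      by_contra h'
      exact h ⟨j, j', hj, hv, h'⟩
    by_cases hA' : ∀ i₀ : ℕ, ∃ i i' : ℕ, i₀ ≤ i ∧ IsAStageAt R P s p i d ∧ IsVisitPair R P i i' ∧
        ¬ ∀ a ∈ R i', ∃ b ∈ R i, O.valuation (a - b) < 1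
    · -- (NR-A): non-rational A-windows recur
      exact hNRA p hp k K O A₀ h₀ t core hrk R P s hR0 hN hrun hnd hhigh h2inf hinf hwild hnp hodd hreg hdim N₁ h0 h1 HΓ d i₁ hdo hd3
        hred hA hA'
    · -- ¬(NR-A) = (B1): W-NRA-B
      have hB1 : ∃ i₀ : ℕ, ∀ i i' : ℕ, i₀ ≤ i → IsAStageAt R P s p i d → IsVisitPair R P i i' →
          ∀ a ∈ R i', ∃ b ∈ R i, O.valuation (a - b) < 1 := by
        by_contra h
        refine hA' fun i₀ => ?_
        by_contra h'
        refine h ⟨i₀, fun i i' hi hAi hv => ?_⟩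
        by_contra h''
        exact h' ⟨i, i', hi, hAi, hv, h''⟩
      exact hB p hp k K O A₀ h₀ t core hrk R P s hR0 hN hrun hnd hhigh h2inf hinf hwild hnp hodd hreg hdim N₁ h0 h1 HΓ d i₁ hdo hd3
        hred hA hB1 hB2

/-- **W-NRA-U ⟸ `H3OneAxisTwoN` (PROVED; the lateness argument of `ArithLeaf.oddArith_of_words` run on ONE axis).** From hH2′ʼs binders:
domination of `R 0` (`subringDominates_locAtCentre`), (S1a) beyond `max N₁ iₕ` (`VisitLawDelta.hS1a_of_run` + the high-order bound for `2 ≤ ν`),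
recurring point steps (from the A-stages), the lateness bound `N₃` (`ArithReduction.exists_bound_of_not_infinite_posStepTwo` from
`¬ HeightTwoStepsInfinite`); a uniaxial A-stage beyond `max (max N₁ iₕ) N₃` then yields a positive step of height ≥ 2 beyond `N₃` — absurd.
OURS. (folklore) -/
theorem uniaxialAStagesNotEternal_of_H3oneAxis (h3 : H3OneAxisTwoN) : UniaxialAStagesNotEternalTwoN := by
  intro p hp2 k K _ _ _ _ _ O A₀ h₀ t core hrk R P s hR0 hN hrun hnd hhigh h2inf hinf hwild hnp hodd hreg hdim N₁ h0 h1 HΓ d i₁ hdo hd3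
    hred hA hio
  subst hp2
  haveI : CharP K 2 := charP_of_injective_algebraMap (algebraMap k K).injective 2
  classical
  obtain ⟨iₕ, hhi⟩ := hhigh
  have hdom0 : SubringDominates (R 0) O.toSubring := by
    rw [hR0]
    exact subringDominates_locAtCentre h₀
  -- one bound for N4, Hγ and the high order
  set N := max N₁ iₕ with hNdef
  have h0' : ∀ j, N ≤ j → IsPointStep R P j → ∀ (hs' : s j ^ 2 ∈ R j) (Q : Ideal (R j)) [Q.IsPrime],
      Q.height = 0 → ¬ SigmaTopLegality.IsSingPrime (R j) 2 ⟨s j ^ 2, hs'⟩ Q :=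
    fun j hj => h0 j (le_of_max_le_left hj)
  have h1' : ∀ j, N ≤ j → IsPointStep R P j → ∀ (hs' : s j ^ 2 ∈ R j) (Q : Ideal (R j)) [Q.IsPrime],
      Q.height = 1 → ¬ SigmaTopLegality.IsSingPrime (R j) 2 ⟨s j ^ 2, hs'⟩ Q :=
    fun j hj => h1 j (le_of_max_le_left hj)
  have HΓ' : ∀ (j j' : ℕ) (x : K), N ≤ j → IsVisitPair R P j j' →
      ((∃ h : x ∈ R j, (⟨x, h⟩ : R j) ∈ P j) ∧ x ≠ 0 ∧ ∀ y : R j, y ∈ P j → O.valuation (y : K) ≤ O.valuation x) →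
      ∀ l, j < l → l < j' → ∃ hx : x ∈ R l, P l = Ideal.span {(⟨x, hx⟩ : R l)} :=
    fun j j' x hj => HΓ j j' x (le_of_max_le_left hj)
  -- (S1a) from the run, in the ν-free shape
  have hS1a := VisitLawDelta.hS1a_of_run hrun hdom0 hreg h1' HΓ'
  have hS1a' : ∀ (j j' : ℕ) (x : K) (ν : ℕ), N ≤ j → IsVisitPair R P j j' →
      ((∃ hx : x ∈ R j, (⟨x, hx⟩ : R j) ∈ P j) ∧ x ≠ 0 ∧ ∀ y : R j, y ∈ P j → O.valuation (y : K) ≤ O.valuation x) →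
      HasCleanedOrderAt R s 2 j ν →
      R j' = R (j + 1) ∧ ∃ G W : K, G ∈ R j' ∧ W ∈ R j' ∧ W⁻¹ ∈ R j' ∧ W ≠ 0 ∧ s j' * x ^ (ν / 2) * W = s j - G :=
    fun j j' x ν hj hv hx hclean =>
      hS1a j j' x ν hj hv hx (ArithLeaf.two_le_of_isHighOrderAt_of_hasCleanedOrderAt (hhi j (le_of_max_le_right hj)) hclean) hclean
  -- point steps recur (from the A-stages)
  have hrec : ∀ i₀, ∃ i, i₀ ≤ i ∧ IsPointStep R P i := fun i₀ => by
    obtain ⟨i, hi, hAi⟩ := hA i₀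
    exact ⟨i, hi, hAi.1⟩
  -- lateness
  obtain ⟨N₃, hlate⟩ := ArithReduction.exists_bound_of_not_infinite_posStepTwo (R := R) (P := P) (fun h => h2inf h)
  -- the one-axis H3 beyond `N`
  have hH3 := h3 K O R P t s hrun hdom0 hrec N hS1a' hreg 4 (by norm_num) hdim h0' h1' d hdo
  -- a late uniaxial A-stage
  obtain ⟨i, hi, hAi, i', u, -, -, hUx, -⟩ := hio (max N N₃)
  obtain ⟨hloc, hs, g, m, c, -, hm, hm2, hcong, hu, hvm⟩ := hUx
  obtain ⟨j', hij', hpos, hht⟩ := hH3 i (le_of_max_le_left hi) hAi hloc hs g m c u hm hm2 hcong hu hvm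
  exact absurd hht (not_le.mpr (hlate j' ((le_of_max_le_right hi).trans hij'.le) hpos))

/-- **hH2′ FROM THE NRA WORDS (PROVED assembly): W-NRA-A ∧ H3-one-axis ∧ W-NRA-B ⟹ `ArithLeaf.LateSwitchBinaryAStageTwoN`.** OURS. (folklore) -/
theorem lateSwitchBinaryAStage_of_words (hW : NonRationalAWindowTwoN) (h3 : H3OneAxisTwoN) (hB : NonRationalBWindowsTwoN) :
    ArithLeaf.LateSwitchBinaryAStageTwoN :=
  lateSwitchBinaryAStage_of_trichotomy
    (lateBinaryAStage_of_nonRationalAWindows hW (uniaxialAStagesNotEternal_of_H3oneAxis h3)) hB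

/-! ## §2 W-NRA-U discharged (res-D-pv-036 g11, RULING 288 (b)(2) FILE 2) -/

/-- **The one-axis H3 word holds**: `H3OneAxisTwoN` (strat-2 words v3) by `ArithReductionLegality.H3_oneAxis_of_pieces`, binder for binder.
[cite: Matsumura1987, Thm. 14.2] [folklore] -/
theorem h3OneAxisTwoN_holds : H3OneAxisTwoN := by
  intro K _ _ O R P t s
  exact ArithReductionLegality.H3_oneAxis_of_pieces

/-- **W-NRA-U holds**: uniaxial-and-not-binary late A-stages with residually non-rational window do not recur beyond every stage
(`UniaxialAStagesNotEternalTwoN`), by the glue `uniaxialAStagesNotEternal_of_H3oneAxis` over `h3OneAxisTwoN_holds`. [folklore] -/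
theorem uniaxialAStagesNotEternalTwoN_holds : UniaxialAStagesNotEternalTwoN :=
  uniaxialAStagesNotEternal_of_H3oneAxis h3OneAxisTwoN_holds

/-- **hH2′ closed modulo W-NRA-A and W-NRA-B**: `lateSwitchBinaryAStage_of_words` with the one-axis word discharged. [folklore] -/
theorem lateSwitchBinaryAStage_of_A_B (hW : NonRationalAWindowTwoN) (hB : NonRationalBWindowsTwoN) :
    ArithLeaf.LateSwitchBinaryAStageTwoN :=
  lateSwitchBinaryAStage_of_words hW h3OneAxisTwoN_holds hB

end Summit.ResolutionOfSingularities.ResolutionOfSingularities.Theorems.SwitchingDichotomy.NonRationalWindow
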